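import Mathlib
import Summits.Ventures.PercRepro2.MixChordOPendantBlock

/-!
# The pendant block at the ROOT OF THE `o`-EDGE plus one edge to the other root
(blind cell PercRepro2, night-1 g23; proofs/NIGHT1-G23.md §6)

MixChordOPendantBlock.lean proves the chord along `{o, a₁}` when `a₃`'s block hangs at `a₂` and `e` joins
`a₃` to `a₁` (and, by the root swap, the chord along `{o, a₂}` when the block hangs at `a₁` and `e` joins `a₃`
to `a₂`).  The remaining orientation — the block at the root `a₁` of the `o`-edge `{o, a₁}`, `e = {a₃, a₂}` —
needs the root-edge closure at the OTHER root (`dChord_of_update_zero'`, p551317), whose `t²` coefficient is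
the `J`-chord: **`dChord_of_update_zero_of_scales'`** (the swapped scaling property), and then
**`dChord_o_edge_of_pendant_block_at_root`** (the block at `v = a₁`, along `{o, v}`) with its root swap
`dChord_o_edge₂_of_pendant_block_at_root` and the chain's rows.  With MixChordOPendantBlock.lean the
pendant-block class holds along BOTH `o`-edges in both orientations.

Own code; standard axioms.
-/

namespace Summit.Ventures.PercRepro2

open UnionCluster CovForm

namespace Mix

namespace Block

open Support Star CutVertexM9

section SwappedClosure

variable {V : Type*} {E : Type*} [Fintype E] [DecidableEq E] [Fintype V] [DecidableEq V]
  {R : Type*} [Field R] [LinearOrder R] [IsStrictOrderedRing R]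

variable {p : E → R} {ends : E → Sym2 V} {o a₁ a₂ a₃ b : V} {e f : E}

/-- **The root-edge closure at the other root under the swapped scaling property**: for `e = {a₂, a₃}` and
`f = {o, a₁}`, if the six root-swapped `Q`-masses scale by the same `c ≥ 0` at `p` and at `p[f ↦ 0]`, the
`D`-chord at `p[e ↦ 0]` gives the `D`-chord at `p` (the `t²` coefficient is the `J`-chord). -/
theorem dChord_of_update_zero_of_scales' (hp : IsProbVec p) (hends : ends e = s(a₂, a₃))
    (hf : ends f = s(o, a₁)) (hef : e ≠ f) {c : R} (hc : 0 ≤ c) (h : Scales p ends o a₂ a₁ b e c)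
    (h0s : Scales (Function.update p f 0) ends o a₂ a₁ b e c)
    (h0 : NMixChord (normD ends a₁ a₂ a₃) (Function.update p e 0) ends o a₁ a₂ a₃ b f) :
    NMixChord (normD ends a₁ a₂ a₃) p ends o a₁ a₂ a₃ b f := by
  refine dChord_of_update_zero' p ends b hp hends hf hef ?_ h0
  rw [sClosure_of_scales h h0s]
  have hp0 : IsProbVec (Function.update p e 0) := hp.update e le_rfl zero_le_one
  have hJ := jChord (Function.update p e 0) ends (a₂ := a₂) b hp0 hf
  rw [Function.update_of_ne hef.symm, Function.update_comm hef] at hJ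
  have hpf : IsProbVec (Function.update p f 0) := hp.update f le_rfl zero_le_one
  have hD0 := prob_nonneg hp0 (PDEvent ends a₂ a₁ a₃)
  have hD00 := prob_nonneg (hpf.update e le_rfl zero_le_one) (PDEvent ends a₂ a₁ a₃)
  refine mul_nonneg (mul_nonneg (pow_nonneg hc 3)
    (mul_nonneg (mul_nonneg (mul_nonneg hD0 hD00) (sq_nonneg _)) (sq_nonneg _))) ?_
  unfold jPrime
  simp only [covC_root_swap (Function.update p e 0) ends a₁ a₂,
    covC_root_swap (Function.update (Function.update p f 0) e 0) ends a₁ a₂]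
  linarith

end SwappedClosure

section Theorem

variable {V : Type*} {E : Type*} [Fintype E] [DecidableEq E] [Fintype V] [DecidableEq V]
  {R : Type*} [Field R] [LinearOrder R] [IsStrictOrderedRing R]

variable (p : E → R) (ends : E → Sym2 V) {o a₂ a₃ v : V} (b : V) {e f : E}
  {side : {e' // e' ∈ others e} → Bool} {L : Set V} {Rt : Set V}

/-- **The pendant block at the root of the `o`-edge**: the graph without `e = {a₃, a₂}` has the cut vertex
`v = a₁` with `a₃` alone on its left side; the chord along `f = {o, v}`. -/
theorem dChord_o_edge_of_pendant_block_at_root (h : CutVertex (restrictEnds (others e) ends) side L v Rt)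
    (hp : IsProbVec p) (he : ends e = s(a₃, a₂)) (h3 : a₃ ∈ L) (ho : o ∈ Rt ∨ o = v)
    (h2 : a₂ ∈ Rt ∨ a₂ = v) (hb : b ∈ Rt ∨ b = v) (hf : ends f = s(o, v)) (hov : o ≠ v) :
    NMixChord (normD ends v a₂ a₃) p ends o v a₂ a₃ b f := by
  have h3v : a₃ ≠ v := fun h' => h.vL (h' ▸ h3)
  have ho3 : o ≠ a₃ := by
    rintro rfl
    rcases ho with ho | ho
    · exact h.disj _ h3 ho
    · exact h3v ho
  have h32 : a₃ ≠ a₂ := by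
    rintro rfl
    rcases h2 with h2 | h2
    · exact h.disj _ h3 h2
    · exact h3v h2
  have hef : e ≠ f := root_ne_o_edge ends hf he ho3 h3v
  have hfS : f ∈ others e := mem_others_of_ne e hef.symm
  have hends : ends e = s(a₂, a₃) := by rw [he, Sym2.eq_swap]
  have hfside : side ⟨f, hfS⟩ = false :=
    side_eq_false_of_right h (f := ⟨f, hfS⟩) (x := o) (y := v) hf ho (Or.inr rfl) hov
  have hc : prob (Support.restrict (others e) (Function.update p f 0))
        {ω' | ¬ Conn (restrictEnds (others e) ends) ω' a₃ v} =
      prob (Support.restrict (others e) p) {ω' | ¬ Conn (restrictEnds (others e) ends) ω' a₃ v} := by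
    rw [Support.restrict_update _ _ hfS]
    refine prob_update_zero_eq_of_free _ ?_
    intro ω ω' hag
    simp only [Set.mem_setOf_eq]
    refine propext (not_congr (conn_left_congr h (Or.inl h3) (Or.inr rfl) fun e' he' => hag e' ?_))
    rintro rfl
    rw [hfside] at he'
    exact Bool.false_ne_true he'
  have hs0 := scales_block (Function.update p f 0) ends b h he h3 ho h2 hb
  rw [hc] at hs0
  refine dChord_of_update_zero_of_scales' hp hends hf hef
    (prob_nonneg (isProbVec_restrict p _ hp) _) (scales_block p ends b h he h3 ho h2 hb) hs0 ?_
  exact dChord_o_edge_a3_behind_a1_support (others e) (update_zero_off_others (p := p) (e := e))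
    ends h (hp.update e le_rfl zero_le_one) h3 ho h2 hb hfS hf hov

/-- **The root swap**: the block at `a₂`, `e = {a₃, a₁}`, the chord along `{o, a₂}`. -/
theorem dChord_o_edge₂_of_pendant_block_at_root {a₁ : V}
    (h : CutVertex (restrictEnds (others e) ends) side L v Rt)
    (hp : IsProbVec p) (he : ends e = s(a₃, a₁)) (h3 : a₃ ∈ L) (ho : o ∈ Rt ∨ o = v)
    (h1 : a₁ ∈ Rt ∨ a₁ = v) (hb : b ∈ Rt ∨ b = v) (hf : ends f = s(o, v)) (hov : o ≠ v) :
    NMixChord (normD ends a₁ v a₃) p ends o a₁ v a₃ b f :=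
  (nMixChord_normD_root_swap p ends b o a₁ v a₃ f).1
    (dChord_o_edge_of_pendant_block_at_root p ends b h hp he h3 ho h1 hb hf hov)

/-- The chain's row: the block at the root of the `o`-edge. -/
theorem dz2Chord_o_edge_of_pendant_block_at_root (h : CutVertex (restrictEnds (others e) ends) side L v Rt)
    (hp : IsProbVec p) (he : ends e = s(a₃, a₂)) (h3 : a₃ ∈ L) (ho : o ∈ Rt ∨ o = v)
    (h2 : a₂ ∈ Rt ∨ a₂ = v) (hb : b ∈ Rt ∨ b = v) (hf : ends f = s(o, v)) (hov : o ≠ v)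
    (h0 : HCov (Function.update p f 0) ends o v a₂ a₃ b) :
    NMixChord (normDZ2 ends v a₂ a₃) p ends o v a₂ a₃ b f :=
  nMixChord_DZ2_of_D hp (dChord_o_edge_of_pendant_block_at_root p ends b h hp he h3 ho h2 hb hf hov) h0

/-- The chain's row, root-swapped. -/
theorem dz2Chord_o_edge₂_of_pendant_block_at_root {a₁ : V}
    (h : CutVertex (restrictEnds (others e) ends) side L v Rt)
    (hp : IsProbVec p) (he : ends e = s(a₃, a₁)) (h3 : a₃ ∈ L) (ho : o ∈ Rt ∨ o = v)
    (h1 : a₁ ∈ Rt ∨ a₁ = v) (hb : b ∈ Rt ∨ b = v) (hf : ends f = s(o, v)) (hov : o ≠ v)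
    (h0 : HCov (Function.update p f 0) ends o a₁ v a₃ b) :
    NMixChord (normDZ2 ends a₁ v a₃) p ends o a₁ v a₃ b f :=
  nMixChord_DZ2_of_D hp (dChord_o_edge₂_of_pendant_block_at_root p ends b h hp he h3 ho h1 hb hf hov) h0

end Theorem

end Block

end Mix

end Summit.Ventures.PercRepro2
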